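import Summits.QuantumAdvantage.QuantumAdvantage.Theorems.CharDialTowerB
import Summits.QuantumAdvantage.QuantumAdvantage.Theorems.CharDialNullDialB
import Summits.QuantumAdvantage.QuantumAdvantage.Theorems.CharDialMaskDialD
import HarnessLib

/-!
# CharDial / JLinPeel — THE DIAL TOWER, part C: the NULL and MASK dials absorbed into the residual on both sides, BY NAME
(route `CharDial`, item 32604; lens-6 node g18 §38d / REV2 §38h; §11.3 land-port)

* `NullHyp D` — `M ≥ 2^ℓ·((log₂ n+1)²+1)` pairwise separated windows of a length `ℓ ≢ 0 (mod 3)` on each of which every form has ZERO SUM;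
  ★ `nullDialLog_hard (p)` (DECIDED for juntas `≤ log₂ n`, every `p`; = `NullDial.nullDial_hard`); `nullHyp_of_blockHyp` (block ⊆ null, `3 ∤ p`),
  `blockDialLog_hard'`; `ResidualHigh4Side` / `LowResidual4Side` / `Residual4Side`, `null_absorb`, ★ `residualHigh3Side_iff_residualHigh4`,
  ★ `lowResidual3Side_iff_lowResidual4`, ★ `residual3Side_iff_residual4`, ★ `walkHardFJLinOdd_iff_residual4`, ★ `walkHardFJLinOdd_iff_residual4_split`,
  `walkHardFJLinOdd_iff_sharpened5`, ★ `highSide_iff_residualHigh4`, ★ `lowSide_iff_lowResidual4`, projections.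
* `MaskHyp D` — the same with a MASK `Z`: windows of length `ℓ` whose unmasked parts `MaskDial.zblk ℓ S Z k` all have size `m ≢ 0 (mod 3)` and zero
  form sums, `M ≥ 2^m·((log₂ n+1)²+1)`; ★ `maskDialLog_hard (p)` (DECIDED; = `MaskDial.maskDial_hard`); `maskHyp_of_nullHyp`, `maskHyp_of_blockHyp`,
  `nullDialLog_hard'`; `ResidualHigh5Side` / `LowResidual5Side` / `Residual5Side`, `mask_absorb`, ★ `residualHigh4Side_iff_residualHigh5`,
  ★ `lowResidual4Side_iff_lowResidual5`, ★ `residual4Side_iff_residual5`, ★ `walkHardFJLinOdd_iff_residual5`,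
  ★ `walkHardFJLinOdd_iff_residual5_split (B) : T ↔ LowResidual5Side B ∧ ResidualHigh5Side B`, `walkHardFJLinOdd_iff_sharpened6`,
  ★ `highSide_iff_residualHigh5`, ★ `lowSide_iff_lowResidual5`, projections, `residual_class5_subset_class4`.

0 sorry.  Part D: the certificate (`closes_split`; the class of `ResidualHigh5Side dialB` is inhabited).
-/

set_option autoImplicit false

namespace Summit.QuantumAdvantage.AdviceFreeQNC0.JLinPeel.Tower

open Finset

variable {n : ℕ}

section NullResidual

variable {p : ℕ}

/-- the NULL DIAL hypothesis on a presentation (threshold explicit in `n`): for some window length `ℓ ≢ 0 (mod 3)` there are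
`M ≥ 2^ℓ·((log₂ n + 1)² + 1)` pairwise separated windows `[S k, S k + ℓ) ⊆ {0,…,n−1}` on each of which every form `D.a g` has ZERO SUM. -/
def NullHyp (D : JLinPeel.JLinData p n) : Prop :=
  ∃ (ℓ M : ℕ) (S : Fin M → ℕ), (ℓ % 3 = 1 ∨ ℓ % 3 = 2) ∧
    ((∀ k k' : Fin M, k < k' → S k + ℓ ≤ S k') ∧ (∀ k : Fin M, S k + ℓ ≤ n)) ∧
    2 ^ ℓ * ((Nat.log 2 n + 1) * (Nat.log 2 n + 1) + 1) ≤ M ∧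
      ∀ g (k : Fin M), ∑ i ∈ Summit.QuantumAdvantage.AdviceFreeQNC0.JLinPeel.BlockDial.blk ℓ S k, D.a g i = 0

/-- ★ **the null dial in the summit's format**: there are `θ < 1` and `n₀` (uniform in `p`) such that for all `n ≥ n₀` every presentation mod `p`
with juntas `≤ log₂ n` satisfying `NullHyp` wins on at most `θ·2ⁿ` inputs (tables arbitrary; no primality). -/
theorem nullDialLog_hard (p : ℕ) :
    ∃ θ : ℝ, θ < 1 ∧ ∃ n₀ : ℕ, ∀ n ≥ n₀, ∀ (c : ℕ) (D : JLinPeel.JLinData p n),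
      (∀ g, (D.J g).card ≤ Nat.log 2 n) → NullHyp D →
        ((Finset.univ.filter fun u : Fin n → Bool => ringWinU c D.strat u = true).card : ℝ) ≤ θ * (2 : ℝ) ^ n := by
  obtain ⟨θ, hθ, N₁, hN⟩ := NullDial.nullDial_hard
  refine ⟨θ, hθ, 2 ^ N₁, fun n hn c D hJ hB => ?_⟩
  obtain ⟨ℓ, M, S, hℓ3, hS, hM, hnull⟩ := hB
  have hlog : N₁ ≤ Nat.log 2 n := by
    have h := Nat.log_mono_right (b := 2) hn
    rwa [Nat.log_pow (by norm_num : 1 < 2)] at h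
  have h1 : 2 ^ ℓ * (N₁ + 1) ≤ M :=
    le_trans (Nat.mul_le_mul_left _ (by nlinarith)) hM
  exact hN ℓ hℓ3 p n M (Nat.log 2 n) S hS h1 hM c D hJ hnull

/-- **the block dial is inside the null dial**: for `3 ∤ p` a presentation satisfying `BlockHyp` satisfies `NullHyp` with `ℓ = p` (a form constant
on a `p`-block has zero sum on it). -/
theorem nullHyp_of_blockHyp (hp3 : p % 3 = 1 ∨ p % 3 = 2) (D : JLinPeel.JLinData p n) (hB : BlockHyp D) : NullHyp D := by
  obtain ⟨M, S, hS, hM, hconst⟩ := hB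
  have hS' : ((∀ k k' : Fin M, k < k' → S k + p ≤ S k') ∧ (∀ k : Fin M, S k + p ≤ n)) := hS
  exact ⟨p, M, S, hp3, hS', hM, fun g k => NullDial.sum_blk_eq_zero_of_const hS' (D.a g) k (hconst g k)⟩

/-- consistency: the summit-format block dial `blockDialLog_hard` re-derived from the null dial. -/
theorem blockDialLog_hard' (p : ℕ) (hp3 : p % 3 = 1 ∨ p % 3 = 2) :
    ∃ θ : ℝ, θ < 1 ∧ ∃ n₀ : ℕ, ∀ n ≥ n₀, ∀ (c : ℕ) (D : JLinPeel.JLinData p n),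
      (∀ g, (D.J g).card ≤ Nat.log 2 n) → BlockHyp D →
        ((Finset.univ.filter fun u : Fin n → Bool => ringWinU c D.strat u = true).card : ℝ) ≤ θ * (2 : ℝ) ^ n := by
  obtain ⟨θ, hθ, n₀, h⟩ := nullDialLog_hard p
  exact ⟨θ, hθ, n₀, fun n hn c D hJ hB => h n hn c D hJ (nullHyp_of_blockHyp hp3 D hB)⟩

/-! #### the residual pieces with FOUR escape clauses, and the symmetric peel by name -/

/-- **piece RESIDUAL-HIGH⁗ (g18).** `WalkHardFJLinOdd` restricted to HIGH-variation strategies all of whose `log₂ n`-junta ⊕ form presentations escape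
the rank dial, the sparse dial, the block dial AND the null dial. -/
def ResidualHigh4Side (B : ℕ → ℕ) : Prop :=
  ∀ (p : ℕ) [Fact p.Prime], 5 ≤ p → ∃ θ : ℝ, θ < 1 ∧ ∃ n₀ : ℕ, ∀ n ≥ n₀, ∀ c : ℕ,
    ∀ y : Fin (n + 1) → (Fin n → Bool) → Bool, JLinHyp p n y → ¬ LowVar B n y →
      (∀ D : JLinPeel.JLinData p n, D.strat = y → (∀ g, (D.J g).card ≤ Nat.log 2 n) →
          ¬ SpanHyp D ∧ ¬ SparseHyp D ∧ ¬ BlockHyp D ∧ ¬ NullHyp D) →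
        ((Finset.univ.filter fun u : Fin n → Bool => ringWinU c y u = true).card : ℝ) ≤ θ * (2 : ℝ) ^ n

/-- **piece LOW-RESIDUAL⁗ (g18).** the same restriction on the LOW-variation side. -/
def LowResidual4Side (B : ℕ → ℕ) : Prop :=
  ∀ (p : ℕ) [Fact p.Prime], 5 ≤ p → ∃ θ : ℝ, θ < 1 ∧ ∃ n₀ : ℕ, ∀ n ≥ n₀, ∀ c : ℕ,
    ∀ y : Fin (n + 1) → (Fin n → Bool) → Bool, JLinHyp p n y → LowVar B n y →
      (∀ D : JLinPeel.JLinData p n, D.strat = y → (∀ g, (D.J g).card ≤ Nat.log 2 n) →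
          ¬ SpanHyp D ∧ ¬ SparseHyp D ∧ ¬ BlockHyp D ∧ ¬ NullHyp D) →
        ((Finset.univ.filter fun u : Fin n → Bool => ringWinU c y u = true).card : ℝ) ≤ θ * (2 : ℝ) ^ n

/-- **the FOUR-DIAL RESIDUAL of T** (no variation condition). -/
def Residual4Side : Prop :=
  ∀ (p : ℕ) [Fact p.Prime], 5 ≤ p → ∃ θ : ℝ, θ < 1 ∧ ∃ n₀ : ℕ, ∀ n ≥ n₀, ∀ c : ℕ,
    ∀ y : Fin (n + 1) → (Fin n → Bool) → Bool, JLinHyp p n y →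
      (∀ D : JLinPeel.JLinData p n, D.strat = y → (∀ g, (D.J g).card ≤ Nat.log 2 n) →
          ¬ SpanHyp D ∧ ¬ SparseHyp D ∧ ¬ BlockHyp D ∧ ¬ NullHyp D) →
        ((Finset.univ.filter fun u : Fin n → Bool => ringWinU c y u = true).card : ℝ) ≤ θ * (2 : ℝ) ^ n

/-- **ABSORPTION OF THE NULL DIAL.** a residual bound with four escape clauses on a variation class `V` gives the residual bound with three escape
clauses on `V` (case split on «some `log₂ n`-junta presentation meets the null dial», `nullDialLog_hard`). -/
theorem null_absorb (p : ℕ) (V : ∀ n : ℕ, (Fin (n + 1) → (Fin n → Bool) → Bool) → Prop)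
    (hR : ∃ θ : ℝ, θ < 1 ∧ ∃ n₀ : ℕ, ∀ n ≥ n₀, ∀ c : ℕ, ∀ y : Fin (n + 1) → (Fin n → Bool) → Bool, JLinHyp p n y → V n y →
      (∀ D : JLinPeel.JLinData p n, D.strat = y → (∀ g, (D.J g).card ≤ Nat.log 2 n) →
          ¬ SpanHyp D ∧ ¬ SparseHyp D ∧ ¬ BlockHyp D ∧ ¬ NullHyp D) →
        ((Finset.univ.filter fun u : Fin n → Bool => ringWinU c y u = true).card : ℝ) ≤ θ * (2 : ℝ) ^ n) :
    ∃ θ : ℝ, θ < 1 ∧ ∃ n₀ : ℕ, ∀ n ≥ n₀, ∀ c : ℕ, ∀ y : Fin (n + 1) → (Fin n → Bool) → Bool, JLinHyp p n y → V n y →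
      (∀ D : JLinPeel.JLinData p n, D.strat = y → (∀ g, (D.J g).card ≤ Nat.log 2 n) →
          ¬ SpanHyp D ∧ ¬ SparseHyp D ∧ ¬ BlockHyp D) →
        ((Finset.univ.filter fun u : Fin n → Bool => ringWinU c y u = true).card : ℝ) ≤ θ * (2 : ℝ) ^ n := by
  obtain ⟨θ₃, hθ₃, n₃, h₃⟩ := nullDialLog_hard p
  obtain ⟨θ₄, hθ₄, n₄, h₄⟩ := hR
  refine ⟨max θ₃ θ₄, max_lt hθ₃ hθ₄, max n₃ n₄, fun n hn c y hy hV hesc => ?_⟩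
  have hpow : (0 : ℝ) ≤ (2 : ℝ) ^ n := by positivity
  have hn3 : n₃ ≤ n := le_trans (le_max_left _ _) hn
  have hn4 : n₄ ≤ n := le_trans (le_max_right _ _) hn
  by_cases hdial : ∃ D : JLinPeel.JLinData p n, D.strat = y ∧ (∀ g, (D.J g).card ≤ Nat.log 2 n) ∧ NullHyp D
  · obtain ⟨D, hDy, hJ, hS⟩ := hdial
    rw [← hDy]
    exact le_trans (h₃ n hn3 c D hJ hS) (mul_le_mul_of_nonneg_right (le_max_left _ _) hpow)
  · have hesc4 : ∀ D : JLinPeel.JLinData p n, D.strat = y → (∀ g, (D.J g).card ≤ Nat.log 2 n) →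
        ¬ SpanHyp D ∧ ¬ SparseHyp D ∧ ¬ BlockHyp D ∧ ¬ NullHyp D := fun D hDy hJ =>
      ⟨(hesc D hDy hJ).1, (hesc D hDy hJ).2.1, (hesc D hDy hJ).2.2, fun hS => hdial ⟨D, hDy, hJ, hS⟩⟩
    exact le_trans (h₄ n hn4 c y hy hV hesc4) (mul_le_mul_of_nonneg_right (le_max_right _ _) hpow)

/-- ★ **RESIDUAL-HIGH‴ ⟺ RESIDUAL-HIGH⁗** (every schedule): the null dial is absorbed on the HIGH side. -/
theorem residualHigh3Side_iff_residualHigh4 (B : ℕ → ℕ) : ResidualHigh3Side B ↔ ResidualHigh4Side B := by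
  constructor
  · intro h p _ hp
    obtain ⟨θ, hθ, n₀, hn₀⟩ := h p hp
    exact ⟨θ, hθ, n₀, fun n hn c y hy hv hesc =>
      hn₀ n hn c y hy hv fun D hDy hJ => ⟨(hesc D hDy hJ).1, (hesc D hDy hJ).2.1, (hesc D hDy hJ).2.2.1⟩⟩
  · intro h p _ hp
    exact null_absorb p (fun n y => ¬ LowVar B n y) (h p hp)

/-- ★ **LOW-RESIDUAL‴ ⟺ LOW-RESIDUAL⁗** (every schedule): the null dial is absorbed on the LOW side. -/
theorem lowResidual3Side_iff_lowResidual4 (B : ℕ → ℕ) : LowResidual3Side B ↔ LowResidual4Side B := by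
  constructor
  · intro h p _ hp
    obtain ⟨θ, hθ, n₀, hn₀⟩ := h p hp
    exact ⟨θ, hθ, n₀, fun n hn c y hy hv hesc =>
      hn₀ n hn c y hy hv fun D hDy hJ => ⟨(hesc D hDy hJ).1, (hesc D hDy hJ).2.1, (hesc D hDy hJ).2.2.1⟩⟩
  · intro h p _ hp
    exact null_absorb p (fun n y => LowVar B n y) (h p hp)

/-- ★ **RESIDUAL‴ ⟺ RESIDUAL⁗**: the null dial is absorbed (no variation condition). -/
theorem residual3Side_iff_residual4 : Residual3Side ↔ Residual4Side := by
  constructor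
  · intro h p _ hp
    obtain ⟨θ, hθ, n₀, hn₀⟩ := h p hp
    exact ⟨θ, hθ, n₀, fun n hn c y hy hesc =>
      hn₀ n hn c y hy fun D hDy hJ => ⟨(hesc D hDy hJ).1, (hesc D hDy hJ).2.1, (hesc D hDy hJ).2.2.1⟩⟩
  · intro h p _ hp
    obtain ⟨θ, hθ, n₀, hn₀⟩ := null_absorb p (fun _ _ => True)
      (by
        obtain ⟨θ, hθ, n₀, hn₀⟩ := h p hp
        exact ⟨θ, hθ, n₀, fun n hn c y hy _ hesc => hn₀ n hn c y hy hesc⟩)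
    exact ⟨θ, hθ, n₀, fun n hn c y hy hesc => hn₀ n hn c y hy trivial hesc⟩

/-- ★ **JUNCTION 7a (proved, by name): T ⟺ its four-dial residual.** -/
theorem walkHardFJLinOdd_iff_residual4 :
    Summit.QuantumAdvantage.QuantumAdvantage.Theses.CharDial.WalkHardFJLinOdd ↔ Residual4Side := by
  rw [walkHardFJLinOdd_iff_residual3, residual3Side_iff_residual4]

/-- ★ **JUNCTION 7 (proved, by name): T ⟺ LOW-RESIDUAL⁗ ∧ RESIDUAL-HIGH⁗** — the variation split with all FOUR decided dials peeled off BOTH sides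
(every schedule `B`). -/
theorem walkHardFJLinOdd_iff_residual4_split (B : ℕ → ℕ) :
    Summit.QuantumAdvantage.QuantumAdvantage.Theses.CharDial.WalkHardFJLinOdd ↔ LowResidual4Side B ∧ ResidualHigh4Side B := by
  rw [walkHardFJLinOdd_iff_residual3_split B, lowResidual3Side_iff_lowResidual4 B, residualHigh3Side_iff_residualHigh4 B]

/-- the typed pieces of this node after g18, by name: T ⟺ LOW-RESIDUAL⁗(dialB) ∧ RESIDUAL-HIGH⁗(dialB). -/
theorem walkHardFJLinOdd_iff_sharpened5 :
    Summit.QuantumAdvantage.QuantumAdvantage.Theses.CharDial.WalkHardFJLinOdd ↔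
      LowResidual4Side dialB ∧ ResidualHigh4Side dialB :=
  walkHardFJLinOdd_iff_residual4_split dialB

/-- ★ **HIGH ⟺ RESIDUAL-HIGH⁗** directly (every schedule). -/
theorem highSide_iff_residualHigh4 (B : ℕ → ℕ) : HighSide B ↔ ResidualHigh4Side B := by
  rw [highSide_iff_residualHigh3 B, residualHigh3Side_iff_residualHigh4 B]

/-- ★ **LOW ⟺ LOW-RESIDUAL⁗** directly (every schedule). -/
theorem lowSide_iff_lowResidual4 (B : ℕ → ℕ) : LowSide B ↔ LowResidual4Side B := by
  rw [lowSide_iff_lowResidual3 B, lowResidual3Side_iff_lowResidual4 B]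

/-- projections: T implies each residual piece (the pieces are WEAKER-or-equal). -/
theorem residualHigh4Side_of_walkHardFJLinOdd (B : ℕ → ℕ)
    (hT : Summit.QuantumAdvantage.QuantumAdvantage.Theses.CharDial.WalkHardFJLinOdd) : ResidualHigh4Side B :=
  ((walkHardFJLinOdd_iff_residual4_split B).mp hT).2

/-- T implies LOW-RESIDUAL⁗ (projection). -/
theorem lowResidual4Side_of_walkHardFJLinOdd (B : ℕ → ℕ)
    (hT : Summit.QuantumAdvantage.QuantumAdvantage.Theses.CharDial.WalkHardFJLinOdd) : LowResidual4Side B :=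
  ((walkHardFJLinOdd_iff_residual4_split B).mp hT).1

end NullResidual

section MaskResidual

variable {p : ℕ}

/-- the MASK DIAL hypothesis on a presentation (threshold explicit in `n`): for some span length `ℓ`, mask `Z` and mask size `m ≢ 0 (mod 3)` there are
`M ≥ 2^m·((log₂ n + 1)² + 1)` pairwise separated span windows `[S k, S k + ℓ) ⊆ {0,…,n−1}` whose masked blocks all have size `m`, on each of which every
form `D.a g` has ZERO SUM. -/
def MaskHyp (D : JLinPeel.JLinData p n) : Prop :=
  ∃ (ℓ m M : ℕ) (S : Fin M → ℕ) (Z : Finset (Fin n)), (m % 3 = 1 ∨ m % 3 = 2) ∧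
    ((∀ k k' : Fin M, k < k' → S k + ℓ ≤ S k') ∧ (∀ k : Fin M, S k + ℓ ≤ n)) ∧
    (∀ k : Fin M, (MaskDial.zblk ℓ S Z k).card = m) ∧
    2 ^ m * ((Nat.log 2 n + 1) * (Nat.log 2 n + 1) + 1) ≤ M ∧
      ∀ g (k : Fin M), ∑ i ∈ MaskDial.zblk ℓ S Z k, D.a g i = 0

/-- ★ **the mask dial in the summit's format**: there are `θ < 1` and `n₀` (uniform in `p`) such that for all `n ≥ n₀` every presentation mod `p`
with juntas `≤ log₂ n` satisfying `MaskHyp` wins on at most `θ·2ⁿ` inputs (tables arbitrary; no primality). -/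
theorem maskDialLog_hard (p : ℕ) :
    ∃ θ : ℝ, θ < 1 ∧ ∃ n₀ : ℕ, ∀ n ≥ n₀, ∀ (c : ℕ) (D : JLinPeel.JLinData p n),
      (∀ g, (D.J g).card ≤ Nat.log 2 n) → MaskHyp D →
        ((Finset.univ.filter fun u : Fin n → Bool => ringWinU c D.strat u = true).card : ℝ) ≤ θ * (2 : ℝ) ^ n := by
  obtain ⟨θ, hθ, N₁, hN⟩ := MaskDial.maskDial_hard
  refine ⟨θ, hθ, 2 ^ N₁, fun n hn c D hJ hB => ?_⟩
  obtain ⟨ℓ, m, M, S, Z, hm3, hS, hm, hM, hnull⟩ := hB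
  have hlog : N₁ ≤ Nat.log 2 n := by
    have h := Nat.log_mono_right (b := 2) hn
    rwa [Nat.log_pow (by norm_num : 1 < 2)] at h
  have h1 : 2 ^ m * (N₁ + 1) ≤ M :=
    le_trans (Nat.mul_le_mul_left _ (by nlinarith)) hM
  exact hN ℓ m hm3 p n M (Nat.log 2 n) S Z hS hm h1 hM c D hJ hnull

/-- **the null dial is inside the mask dial**: a presentation satisfying `NullHyp` satisfies `MaskHyp` with `Z = univ`, `m = ℓ`. -/
theorem maskHyp_of_nullHyp (D : JLinPeel.JLinData p n) (hB : NullHyp D) : MaskHyp D := by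
  obtain ⟨ℓ, M, S, hℓ3, hS, hM, hnull⟩ := hB
  have hzb : ∀ k : Fin M, MaskDial.zblk ℓ S (Finset.univ : Finset (Fin n)) k
      = Summit.QuantumAdvantage.AdviceFreeQNC0.JLinPeel.BlockDial.blk ℓ S k :=
    fun k => MaskDial.zblk_eq_blk_of_subset k (Finset.subset_univ _)
  exact ⟨ℓ, ℓ, M, S, Finset.univ, hℓ3, hS,
    fun k => by rw [hzb k]; exact Summit.QuantumAdvantage.AdviceFreeQNC0.JLinPeel.BlockDial.card_blk hS k, hM,
    fun g k => by rw [hzb k]; exact hnull g k⟩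

/-- … hence the block dial is inside the mask dial (`3 ∤ p`). -/
theorem maskHyp_of_blockHyp (hp3 : p % 3 = 1 ∨ p % 3 = 2) (D : JLinPeel.JLinData p n) (hB : BlockHyp D) : MaskHyp D :=
  maskHyp_of_nullHyp D (nullHyp_of_blockHyp hp3 D hB)

/-- consistency: the summit-format null dial `nullDialLog_hard` re-derived from the mask dial. -/
theorem nullDialLog_hard' (p : ℕ) :
    ∃ θ : ℝ, θ < 1 ∧ ∃ n₀ : ℕ, ∀ n ≥ n₀, ∀ (c : ℕ) (D : JLinPeel.JLinData p n),
      (∀ g, (D.J g).card ≤ Nat.log 2 n) → NullHyp D →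
        ((Finset.univ.filter fun u : Fin n → Bool => ringWinU c D.strat u = true).card : ℝ) ≤ θ * (2 : ℝ) ^ n := by
  obtain ⟨θ, hθ, n₀, h⟩ := maskDialLog_hard p
  exact ⟨θ, hθ, n₀, fun n hn c D hJ hB => h n hn c D hJ (maskHyp_of_nullHyp D hB)⟩

/-! #### the residual pieces with FIVE escape clauses, and the symmetric peel by name -/

/-- **piece RESIDUAL-HIGH⁵ (g18 REV2).** `WalkHardFJLinOdd` restricted to HIGH-variation strategies all of whose `log₂ n`-junta ⊕ form presentations
escape the rank dial, the sparse dial, the block dial, the null dial AND the mask dial. -/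
def ResidualHigh5Side (B : ℕ → ℕ) : Prop :=
  ∀ (p : ℕ) [Fact p.Prime], 5 ≤ p → ∃ θ : ℝ, θ < 1 ∧ ∃ n₀ : ℕ, ∀ n ≥ n₀, ∀ c : ℕ,
    ∀ y : Fin (n + 1) → (Fin n → Bool) → Bool, JLinHyp p n y → ¬ LowVar B n y →
      (∀ D : JLinPeel.JLinData p n, D.strat = y → (∀ g, (D.J g).card ≤ Nat.log 2 n) →
          ¬ SpanHyp D ∧ ¬ SparseHyp D ∧ ¬ BlockHyp D ∧ ¬ NullHyp D ∧ ¬ MaskHyp D) →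
        ((Finset.univ.filter fun u : Fin n → Bool => ringWinU c y u = true).card : ℝ) ≤ θ * (2 : ℝ) ^ n

/-- **piece LOW-RESIDUAL⁵ (g18 REV2).** the same restriction on the LOW-variation side. -/
def LowResidual5Side (B : ℕ → ℕ) : Prop :=
  ∀ (p : ℕ) [Fact p.Prime], 5 ≤ p → ∃ θ : ℝ, θ < 1 ∧ ∃ n₀ : ℕ, ∀ n ≥ n₀, ∀ c : ℕ,
    ∀ y : Fin (n + 1) → (Fin n → Bool) → Bool, JLinHyp p n y → LowVar B n y →
      (∀ D : JLinPeel.JLinData p n, D.strat = y → (∀ g, (D.J g).card ≤ Nat.log 2 n) →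
          ¬ SpanHyp D ∧ ¬ SparseHyp D ∧ ¬ BlockHyp D ∧ ¬ NullHyp D ∧ ¬ MaskHyp D) →
        ((Finset.univ.filter fun u : Fin n → Bool => ringWinU c y u = true).card : ℝ) ≤ θ * (2 : ℝ) ^ n

/-- **the FIVE-DIAL RESIDUAL of T** (no variation condition). -/
def Residual5Side : Prop :=
  ∀ (p : ℕ) [Fact p.Prime], 5 ≤ p → ∃ θ : ℝ, θ < 1 ∧ ∃ n₀ : ℕ, ∀ n ≥ n₀, ∀ c : ℕ,
    ∀ y : Fin (n + 1) → (Fin n → Bool) → Bool, JLinHyp p n y →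
      (∀ D : JLinPeel.JLinData p n, D.strat = y → (∀ g, (D.J g).card ≤ Nat.log 2 n) →
          ¬ SpanHyp D ∧ ¬ SparseHyp D ∧ ¬ BlockHyp D ∧ ¬ NullHyp D ∧ ¬ MaskHyp D) →
        ((Finset.univ.filter fun u : Fin n → Bool => ringWinU c y u = true).card : ℝ) ≤ θ * (2 : ℝ) ^ n

/-- **ABSORPTION OF THE MASK DIAL.** a residual bound with five escape clauses on a variation class `V` gives the residual bound with four escape
clauses on `V` (case split on «some `log₂ n`-junta presentation meets the mask dial», `maskDialLog_hard`). -/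
theorem mask_absorb (p : ℕ) (V : ∀ n : ℕ, (Fin (n + 1) → (Fin n → Bool) → Bool) → Prop)
    (hR : ∃ θ : ℝ, θ < 1 ∧ ∃ n₀ : ℕ, ∀ n ≥ n₀, ∀ c : ℕ, ∀ y : Fin (n + 1) → (Fin n → Bool) → Bool, JLinHyp p n y → V n y →
      (∀ D : JLinPeel.JLinData p n, D.strat = y → (∀ g, (D.J g).card ≤ Nat.log 2 n) →
          ¬ SpanHyp D ∧ ¬ SparseHyp D ∧ ¬ BlockHyp D ∧ ¬ NullHyp D ∧ ¬ MaskHyp D) →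
        ((Finset.univ.filter fun u : Fin n → Bool => ringWinU c y u = true).card : ℝ) ≤ θ * (2 : ℝ) ^ n) :
    ∃ θ : ℝ, θ < 1 ∧ ∃ n₀ : ℕ, ∀ n ≥ n₀, ∀ c : ℕ, ∀ y : Fin (n + 1) → (Fin n → Bool) → Bool, JLinHyp p n y → V n y →
      (∀ D : JLinPeel.JLinData p n, D.strat = y → (∀ g, (D.J g).card ≤ Nat.log 2 n) →
          ¬ SpanHyp D ∧ ¬ SparseHyp D ∧ ¬ BlockHyp D ∧ ¬ NullHyp D) →
        ((Finset.univ.filter fun u : Fin n → Bool => ringWinU c y u = true).card : ℝ) ≤ θ * (2 : ℝ) ^ n := by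
  obtain ⟨θ₃, hθ₃, n₃, h₃⟩ := maskDialLog_hard p
  obtain ⟨θ₄, hθ₄, n₄, h₄⟩ := hR
  refine ⟨max θ₃ θ₄, max_lt hθ₃ hθ₄, max n₃ n₄, fun n hn c y hy hV hesc => ?_⟩
  have hpow : (0 : ℝ) ≤ (2 : ℝ) ^ n := by positivity
  have hn3 : n₃ ≤ n := le_trans (le_max_left _ _) hn
  have hn4 : n₄ ≤ n := le_trans (le_max_right _ _) hn
  by_cases hdial : ∃ D : JLinPeel.JLinData p n, D.strat = y ∧ (∀ g, (D.J g).card ≤ Nat.log 2 n) ∧ MaskHyp D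
  · obtain ⟨D, hDy, hJ, hS⟩ := hdial
    rw [← hDy]
    exact le_trans (h₃ n hn3 c D hJ hS) (mul_le_mul_of_nonneg_right (le_max_left _ _) hpow)
  · have hesc5 : ∀ D : JLinPeel.JLinData p n, D.strat = y → (∀ g, (D.J g).card ≤ Nat.log 2 n) →
        ¬ SpanHyp D ∧ ¬ SparseHyp D ∧ ¬ BlockHyp D ∧ ¬ NullHyp D ∧ ¬ MaskHyp D := fun D hDy hJ =>
      ⟨(hesc D hDy hJ).1, (hesc D hDy hJ).2.1, (hesc D hDy hJ).2.2.1, (hesc D hDy hJ).2.2.2, fun hS => hdial ⟨D, hDy, hJ, hS⟩⟩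
    exact le_trans (h₄ n hn4 c y hy hV hesc5) (mul_le_mul_of_nonneg_right (le_max_right _ _) hpow)

/-- ★ **RESIDUAL-HIGH⁗ ⟺ RESIDUAL-HIGH⁵** (every schedule): the mask dial is absorbed on the HIGH side. -/
theorem residualHigh4Side_iff_residualHigh5 (B : ℕ → ℕ) : ResidualHigh4Side B ↔ ResidualHigh5Side B := by
  constructor
  · intro h p _ hp
    obtain ⟨θ, hθ, n₀, hn₀⟩ := h p hp
    exact ⟨θ, hθ, n₀, fun n hn c y hy hv hesc =>
      hn₀ n hn c y hy hv fun D hDy hJ => ⟨(hesc D hDy hJ).1, (hesc D hDy hJ).2.1, (hesc D hDy hJ).2.2.1, (hesc D hDy hJ).2.2.2.1⟩⟩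
  · intro h p _ hp
    exact mask_absorb p (fun n y => ¬ LowVar B n y) (h p hp)

/-- ★ **LOW-RESIDUAL⁗ ⟺ LOW-RESIDUAL⁵** (every schedule): the mask dial is absorbed on the LOW side. -/
theorem lowResidual4Side_iff_lowResidual5 (B : ℕ → ℕ) : LowResidual4Side B ↔ LowResidual5Side B := by
  constructor
  · intro h p _ hp
    obtain ⟨θ, hθ, n₀, hn₀⟩ := h p hp
    exact ⟨θ, hθ, n₀, fun n hn c y hy hv hesc =>
      hn₀ n hn c y hy hv fun D hDy hJ => ⟨(hesc D hDy hJ).1, (hesc D hDy hJ).2.1, (hesc D hDy hJ).2.2.1, (hesc D hDy hJ).2.2.2.1⟩⟩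
  · intro h p _ hp
    exact mask_absorb p (fun n y => LowVar B n y) (h p hp)

/-- ★ **RESIDUAL⁗ ⟺ RESIDUAL⁵**: the mask dial is absorbed (no variation condition). -/
theorem residual4Side_iff_residual5 : Residual4Side ↔ Residual5Side := by
  constructor
  · intro h p _ hp
    obtain ⟨θ, hθ, n₀, hn₀⟩ := h p hp
    exact ⟨θ, hθ, n₀, fun n hn c y hy hesc =>
      hn₀ n hn c y hy fun D hDy hJ => ⟨(hesc D hDy hJ).1, (hesc D hDy hJ).2.1, (hesc D hDy hJ).2.2.1, (hesc D hDy hJ).2.2.2.1⟩⟩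
  · intro h p _ hp
    obtain ⟨θ, hθ, n₀, hn₀⟩ := mask_absorb p (fun _ _ => True)
      (by
        obtain ⟨θ, hθ, n₀, hn₀⟩ := h p hp
        exact ⟨θ, hθ, n₀, fun n hn c y hy _ hesc => hn₀ n hn c y hy hesc⟩)
    exact ⟨θ, hθ, n₀, fun n hn c y hy hesc => hn₀ n hn c y hy trivial hesc⟩

/-- ★ **JUNCTION 8a (proved, by name): T ⟺ its five-dial residual.** -/
theorem walkHardFJLinOdd_iff_residual5 :
    Summit.QuantumAdvantage.QuantumAdvantage.Theses.CharDial.WalkHardFJLinOdd ↔ Residual5Side := by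
  rw [walkHardFJLinOdd_iff_residual4, residual4Side_iff_residual5]

/-- ★ **JUNCTION 8 (proved, by name): T ⟺ LOW-RESIDUAL⁵ ∧ RESIDUAL-HIGH⁵** — the variation split with all FIVE decided dials peeled off BOTH sides
(every schedule `B`). -/
theorem walkHardFJLinOdd_iff_residual5_split (B : ℕ → ℕ) :
    Summit.QuantumAdvantage.QuantumAdvantage.Theses.CharDial.WalkHardFJLinOdd ↔ LowResidual5Side B ∧ ResidualHigh5Side B := by
  rw [walkHardFJLinOdd_iff_residual4_split B, lowResidual4Side_iff_lowResidual5 B, residualHigh4Side_iff_residualHigh5 B]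

/-- the typed pieces of this node after g18 REV2, by name: T ⟺ LOW-RESIDUAL⁵(dialB) ∧ RESIDUAL-HIGH⁵(dialB). -/
theorem walkHardFJLinOdd_iff_sharpened6 :
    Summit.QuantumAdvantage.QuantumAdvantage.Theses.CharDial.WalkHardFJLinOdd ↔
      LowResidual5Side dialB ∧ ResidualHigh5Side dialB :=
  walkHardFJLinOdd_iff_residual5_split dialB

/-- ★ **HIGH ⟺ RESIDUAL-HIGH⁵** directly (every schedule). -/
theorem highSide_iff_residualHigh5 (B : ℕ → ℕ) : HighSide B ↔ ResidualHigh5Side B := by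
  rw [highSide_iff_residualHigh4 B, residualHigh4Side_iff_residualHigh5 B]

/-- ★ **LOW ⟺ LOW-RESIDUAL⁵** directly (every schedule). -/
theorem lowSide_iff_lowResidual5 (B : ℕ → ℕ) : LowSide B ↔ LowResidual5Side B := by
  rw [lowSide_iff_lowResidual4 B, lowResidual4Side_iff_lowResidual5 B]

/-- projections: T implies each residual piece (the pieces are WEAKER-or-equal). -/
theorem residualHigh5Side_of_walkHardFJLinOdd (B : ℕ → ℕ)
    (hT : Summit.QuantumAdvantage.QuantumAdvantage.Theses.CharDial.WalkHardFJLinOdd) : ResidualHigh5Side B :=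
  ((walkHardFJLinOdd_iff_residual5_split B).mp hT).2

/-- T implies LOW-RESIDUAL⁵ (projection). -/
theorem lowResidual5Side_of_walkHardFJLinOdd (B : ℕ → ℕ)
    (hT : Summit.QuantumAdvantage.QuantumAdvantage.Theses.CharDial.WalkHardFJLinOdd) : LowResidual5Side B :=
  ((walkHardFJLinOdd_iff_residual5_split B).mp hT).1

/-- the hypothesis class of RESIDUAL-HIGH⁵ is contained in that of RESIDUAL-HIGH⁗ (the fifth peel is monotone; strictness at the strategy level is
OPEN, NODE-g18.md §8). -/
theorem residual_class5_subset_class4 (p : ℕ) (B : ℕ → ℕ) (n : ℕ) (y : Fin (n + 1) → (Fin n → Bool) → Bool)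
    (h : JLinHyp p n y ∧ ¬ LowVar B n y ∧
          ∀ D : JLinPeel.JLinData p n, D.strat = y → (∀ g, (D.J g).card ≤ Nat.log 2 n) →
            ¬ SpanHyp D ∧ ¬ SparseHyp D ∧ ¬ BlockHyp D ∧ ¬ NullHyp D ∧ ¬ MaskHyp D) :
    JLinHyp p n y ∧ ¬ LowVar B n y ∧
      ∀ D : JLinPeel.JLinData p n, D.strat = y → (∀ g, (D.J g).card ≤ Nat.log 2 n) →
        ¬ SpanHyp D ∧ ¬ SparseHyp D ∧ ¬ BlockHyp D ∧ ¬ NullHyp D :=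
  ⟨h.1, h.2.1, fun D hDy hJ => ⟨(h.2.2 D hDy hJ).1, (h.2.2 D hDy hJ).2.1, (h.2.2 D hDy hJ).2.2.1, (h.2.2 D hDy hJ).2.2.2.1⟩⟩

end MaskResidual

end Summit.QuantumAdvantage.AdviceFreeQNC0.JLinPeel.Tower
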